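import Summits.BirchSwinnertonDyer.Rank1Residual.GaloisImage.PsiThreeKummerQuarticRoot
import HarnessLib

/-!
# The two shapes on which `Ψ₃` is irreducible over `ℚ₃` with a root in `K₄ = ℚ₃(3^{1/4})`
# (cell `b2b-bsdres`, team n1011, row T-SSQ3, seat n1011-p05 GEN 11, FILE F2b — class-free TOOL)

HONEST FRAMING (cell `b2b-bsdres`, run/shared/lean/b2b/bsd-rank1-residual/, verbatim in every
file): the goal of the cell is to DELETE the COMBINATION-SHAPED residual classes of the
Birch–Swinnerton-Dyer formula for ALL analytic-rank `≤ 1` elliptic curves over `ℚ` — "full BSD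
formula for every rank `≤ 1` curve in class `C`" assembled STRICTLY from published theorems — so
that the rank-`≤ 1` remainder becomes exactly the CONSTRUCTION-SHAPED classes, which are TYPED
(missing-input `Prop`s), NOT attempted. This is not "finishing BSD". Team n1011; row T-SSQ3
(`cells/n1011/skel/T-SSQ3.md`) = a KERNEL proof of the O5 cell's node T19a
`O5.SupersingularLocalClassUniqueThree`. This file: TOOL theorems only — no definition, no named
fact, no `sorry`; nothing about any particular curve; nothing booked.

## What

For a Weierstrass model `M` over `ℤ₃` (`Ψ₃ = 3x⁴ + b₂x³ + 3b₄x² + 3b₆x + b₈`), with `K₄ = ℚ₃(ϖ)`,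
`ϖ⁴ = 3` (FILE F1 `QuarticKummerThreeAdicHensel`) and the transports / Eisenstein helpers of FILE F2a
`PsiThreeKummerQuarticRoot`:

* (G) THE GOOD SUPERSINGULAR SHAPE `3 ∣ b₂`, `b₈ ≡ −1 (mod 3)` (at a good supersingular `3`:
  `3 ∣ b₂` is supersingularity of the reduction, and `b₈ ≡ −b₄² ≡ −1` follows from `3 ∤ Δ`): the
  reversed quartic `b₈y⁴ + 3b₆y³ + 3b₄y² + b₂y + 3` is EISENSTEIN at `3` and primitive, so `Ψ₃` is
  irreducible over `ℚ₃` (`irreducible_Ψ₃_of_goodShape`); and `Ψ₃` has a root in `K₄`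
  (`exists_kummerRoot_Ψ₃_of_goodShape`: `y = ϖζ` with `ζ` the Hensel root of F1's quartic shape
  `z⁴ + (b₆/b₈)ϖ³z³ + (b₄/b₈)ϖ²z² + (b₂/3b₈)ϖz + 1/b₈`, then `x = 1/y`).
* (T) THE `III*` SHAPE `27 ∣ b₂, 27 ∣ b₄, 81 ∣ b₆, b₈ = 3⁶β₈, β₈ ≡ −1 (mod 3)` (Tate's normal form
  of type `III*` with no `ℚ₃`-rational root of `Ψ₃`): `Ψ₃(3t) = 3⁵ · (t⁴ + 3β₂t³ + 3β₄t² + 3β₆t + 3β₈)`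
  with an EISENSTEIN monic quartic, so `Ψ₃` is irreducible (`irreducible_Ψ₃_of_IIIstarShape`) and
  has the root `x = 3ϖζ ∈ K₄` (`exists_kummerRoot_Ψ₃_of_IIIstarShape`).
* `irreducible_and_exists_aeval_of_kummerRoots` — two curves over `ℚ₃` whose `Ψ₃` have roots in
  `K₄`, the first irreducible, satisfy the conclusion shape of `O5.SameDivisionQuarticAtThree`
  (F1 `exists_aeval_eq_zero_of_roots_in_kummerField`).

So on both shapes `ℚ₃(x(P)) ≅ ℚ₃(3^{1/4})` for every `3`-torsion point `P`.

References: J.-P. Serre, Invent. Math. 15 (1972) §1.11 (motivation only) [Serre1972]; J. H. Silverman,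
*AEC* III.1, Ex. 3.7; *ATAEC* IV.9.4 Step 9 (the `III*` normal form) [SilvermanAEC2009]
[SilvermanATAEC1994]; cells/n1011/skel/T-SSQ3.md.
-/

noncomputable section

open Polynomial

namespace Summit.BirchSwinnertonDyer.Rank1Residual.GaloisImage.PsiThreeKummer

open Summit.BirchSwinnertonDyer.Rank1Residual.GaloisImage.QuarticKummerThree

/-! ## §1 (G) The good supersingular shape: `3 ∣ b₂`, `b₈ ≡ −1 (mod 3)` -/

section Good

variable (M : WeierstrassCurve ℤ_[3]) (h2 : (3 : ℤ_[3]) ∣ M.b₂) (h8 : (3 : ℤ_[3]) ∣ M.b₈ + 1)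
include h2 h8

omit h2 in
/-- On the good supersingular shape `b₈` is a `3`-adic unit (`b₈ ≡ −1`). [folklore] -/
theorem isUnit_b₈_of_goodShape : IsUnit M.b₈ := by
  by_contra hu
  have hmem : M.b₈ ∈ IsLocalRing.maximalIdeal ℤ_[3] := (IsLocalRing.mem_maximalIdeal _).mpr hu
  have h1 : M.b₈ + 1 ∈ IsLocalRing.maximalIdeal ℤ_[3] := by
    rw [PadicInt.maximalIdeal_eq_span_p, Ideal.mem_span_singleton]
    exact_mod_cast h8
  have h : (1 : ℤ_[3]) ∈ IsLocalRing.maximalIdeal ℤ_[3] := by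
    simpa using Ideal.sub_mem _ h1 hmem
  exact (IsLocalRing.maximalIdeal.isMaximal ℤ_[3]).ne_top
    (Ideal.eq_top_of_isUnit_mem _ h isUnit_one)

omit h2 h8 in
/-- `3 ∈ 𝔪_{ℤ₃}`. [folklore] -/
theorem three_mem_maximalIdeal : (3 : ℤ_[3]) ∈ IsLocalRing.maximalIdeal ℤ_[3] := by
  rw [PadicInt.maximalIdeal_eq_span_p, Ideal.mem_span_singleton]
  exact ⟨1, by norm_num⟩

/-- **(G1) `Ψ₃` is irreducible over `ℚ₃` on the good supersingular shape**: the reversed quartic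
`b₈y⁴ + 3b₆y³ + 3b₄y² + b₂y + 3` is Eisenstein at `3` over `ℤ₃` and primitive (leading
coefficient a unit), hence irreducible over `ℚ₃` by Gauss's lemma; reversal reflects
irreducibility (constant term `b₈ ≠ 0`). [folklore] -/
theorem irreducible_Ψ₃_of_goodShape :
    Irreducible (M.map (algebraMap ℤ_[3] ℚ_[3])).Ψ₃ := by
  have hu := isUnit_b₈_of_goodShape M h8
  have hb8 : M.b₈ ≠ 0 := hu.ne_zero
  -- the reversed quartic over `ℤ₃`
  set Rv : ℤ_[3][X] := Polynomial.C M.b₈ * X ^ 4 + Polynomial.C (3 * M.b₆) * X ^ 3 +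
    Polynomial.C (3 * M.b₄) * X ^ 2 + Polynomial.C M.b₂ * X + Polynomial.C 3 with hRv
  have hb2 : M.b₂ ∈ IsLocalRing.maximalIdeal ℤ_[3] := by
    rw [PadicInt.maximalIdeal_eq_span_p, Ideal.mem_span_singleton]
    exact_mod_cast h2
  have hEis : Rv.IsEisensteinAt (IsLocalRing.maximalIdeal ℤ_[3]) :=
    isEisensteinAt_quartic hb8 (fun h ↦ (IsLocalRing.mem_maximalIdeal _).mp h hu)
      (Ideal.mul_mem_right _ _ three_mem_maximalIdeal)
      (Ideal.mul_mem_right _ _ three_mem_maximalIdeal) hb2 three_mem_maximalIdeal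
      three_not_mem_maximalIdeal_sq
  have hprim : Rv.IsPrimitive := by
    rw [isPrimitive_iff_isUnit_of_C_dvd]
    intro r hr
    rw [C_dvd_iff_dvd_coeff] at hr
    have h4 := hr 4
    rw [hRv, coeff_quartic, if_pos rfl] at h4
    exact isUnit_of_dvd_unit h4 hu
  have hdeg : Rv.natDegree = 4 := natDegree_quartic hb8
  have hirr : Irreducible Rv :=
    hEis.irreducible (IsLocalRing.maximalIdeal.isMaximal ℤ_[3]).isPrime hprim (by rw [hdeg]; norm_num)
  have hirrK : Irreducible (Rv.map (algebraMap ℤ_[3] ℚ_[3])) :=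
    (hprim.irreducible_iff_irreducible_map_fraction_map (K := ℚ_[3])).mp hirr
  have hmap : Rv.map (algebraMap ℤ_[3] ℚ_[3]) = (M.map (algebraMap ℤ_[3] ℚ_[3])).Ψ₃.reverse := by
    rw [reverse_Ψ₃ _ (by norm_num), hRv]
    simp only [Polynomial.map_add, Polynomial.map_mul, Polynomial.map_pow, Polynomial.map_C,
      Polynomial.map_X, Polynomial.map_ofNat, WeierstrassCurve.map_b₂, WeierstrassCurve.map_b₄,
      WeierstrassCurve.map_b₆, WeierstrassCurve.map_b₈, map_mul, map_ofNat]
  rw [hmap] at hirrK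
  refine irreducible_of_irreducible_reverse ?_ hirrK
  rw [coeff_Ψ₃_zero, WeierstrassCurve.map_b₈, PadicInt.algebraMap_apply]
  exact PadicInt.coe_ne_zero.mpr hb8

/-- **(G2) `Ψ₃` has a root in `K₄ = ℚ₃(ϖ)` on the good supersingular shape**: with `b₂ = 3t`,
`u = b₈` (a unit), the Hensel root `ζ ∈ K₄` of `z⁴ + (b₆/u)ϖ³z³ + (b₄/u)ϖ²z² + (t/u)ϖz + 1/u`
(F1 `exists_root_quarticShape`, as `1/u ≡ −1`) gives `y = ϖζ` with
`b₈y⁴ + 3b₆y³ + 3b₄y² + b₂y + 3 = 3u · 0 = 0`, `y ≠ 0`, and `x = 1/y` is a root of `Ψ₃`.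
[folklore] -/
theorem exists_kummerRoot_Ψ₃_of_goodShape :
    ∃ x : AdjoinRoot (X ^ 4 - C (3 : ℚ_[3])), aeval x (M.map (algebraMap ℤ_[3] ℚ_[3])).Ψ₃ = 0 := by
  haveI : Fact (Irreducible (X ^ 4 - C (3 : ℚ_[3]))) := ⟨irreducible_kummerQuartic⟩
  haveI := charZero_kummerField
  set ι : ℤ_[3] →+* AdjoinRoot (X ^ 4 - C (3 : ℚ_[3])) := algebraMap ℤ_[3] _ with hι
  set ϖ : AdjoinRoot (X ^ 4 - C (3 : ℚ_[3])) := AdjoinRoot.root (X ^ 4 - C (3 : ℚ_[3])) with hϖ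
  have hϖ4 : ϖ ^ 4 = 3 := root_pow_four
  have hu := isUnit_b₈_of_goodShape M h8
  obtain ⟨t, ht⟩ := h2
  obtain ⟨k, hk⟩ := h8
  set u : ℤ_[3]ˣ := hu.unit with hudef
  have huval : (u : ℤ_[3]) = M.b₈ := hu.unit_spec
  have hinv : ((u⁻¹ : ℤ_[3]ˣ) : ℤ_[3]) * M.b₈ = 1 := by rw [← huval, Units.inv_mul]
  -- the coefficients of F1's quartic shape
  set c₀ : ℤ_[3] := ((u⁻¹ : ℤ_[3]ˣ) : ℤ_[3]) with hc₀
  set c₁ : ℤ_[3] := t * c₀ with hc₁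
  set c₂ : ℤ_[3] := M.b₄ * c₀ with hc₂
  set c₃ : ℤ_[3] := M.b₆ * c₀ with hc₃
  have hc₀' : (3 : ℤ_[3]) ∣ c₀ + 1 := ⟨k * c₀, by linear_combination c₀ * hk - hinv⟩
  obtain ⟨ζ, hζ⟩ := exists_root_quarticShape c₀ c₁ c₂ c₃ hc₀'
  simp only [← algebraMap_padicInt_kummerField, ← hι] at hζ
  -- scalar identities, pushed to `K₄`
  have e₀ : ι M.b₈ * ι c₀ = 1 := by rw [← map_mul, mul_comm, hinv, map_one]
  have e₁ : ι M.b₈ * ι c₁ = ι t := by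
    rw [← map_mul, hc₁, show M.b₈ * (t * c₀) = t * (c₀ * M.b₈) by ring, hinv, mul_one]
  have e₂ : ι M.b₈ * ι c₂ = ι M.b₄ := by
    rw [← map_mul, hc₂, show M.b₈ * (M.b₄ * c₀) = M.b₄ * (c₀ * M.b₈) by ring, hinv, mul_one]
  have e₃ : ι M.b₈ * ι c₃ = ι M.b₆ := by
    rw [← map_mul, hc₃, show M.b₈ * (M.b₆ * c₀) = M.b₆ * (c₀ * M.b₈) by ring, hinv, mul_one]
  have eb₂ : ι M.b₂ = 3 * ι t := by rw [ht, map_mul, map_ofNat ι 3]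
  -- the reversed quartic vanishes at `y = ϖζ`
  set y := ϖ * ζ with hy
  have hR : ι M.b₈ * y ^ 4 + 3 * ι M.b₆ * y ^ 3 + 3 * ι M.b₄ * y ^ 2 + ι M.b₂ * y + 3 = 0 := by
    rw [hy]
    linear_combination (3 * ι M.b₈) * hζ + (ι M.b₈ * ζ ^ 4) * hϖ4 -
      (3 * ϖ ^ 3 * ζ ^ 3) * e₃ - (3 * ϖ ^ 2 * ζ ^ 2) * e₂ + (ϖ * ζ) * eb₂ -
      (3 * ϖ * ζ) * e₁ - 3 * e₀
  have hy0 : y ≠ 0 := by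
    rintro h0
    rw [h0] at hR
    norm_num at hR
  refine ⟨y⁻¹, ?_⟩
  rw [aeval_Ψ₃_map, ← hι, map_mul, map_mul, map_ofNat ι 3]
  have key : 3 * y⁻¹ ^ 4 + ι M.b₂ * y⁻¹ ^ 3 + 3 * ι M.b₄ * y⁻¹ ^ 2 + 3 * ι M.b₆ * y⁻¹ +
      ι M.b₈ = y⁻¹ ^ 4 * (ι M.b₈ * y ^ 4 + 3 * ι M.b₆ * y ^ 3 + 3 * ι M.b₄ * y ^ 2 +
        ι M.b₂ * y + 3) := by
    field_simp
    ring
  rw [key, hR, mul_zero]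

end Good

/-! ## §2 (T) The `III*` shape: `27 ∣ b₂, 27 ∣ b₄, 81 ∣ b₆, b₈ = 3⁶β₈, β₈ ≡ −1 (mod 3)` -/

section IIIstar

variable (M : WeierstrassCurve ℤ_[3]) {β₂ β₄ β₆ β₈ : ℤ_[3]} (hb₂ : M.b₂ = 27 * β₂)
  (hb₄ : M.b₄ = 27 * β₄) (hb₆ : M.b₆ = 81 * β₆) (hb₈ : M.b₈ = 729 * β₈)
  (hβ₈ : (3 : ℤ_[3]) ∣ β₈ + 1)
include hb₂ hb₄ hb₆ hb₈ hβ₈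

omit hb₂ hb₄ hb₆ hb₈ in
/-- On the `III*` shape `β₈ = b₈/3⁶` is a `3`-adic unit (`β₈ ≡ −1`). [folklore] -/
theorem isUnit_β₈_of_IIIstarShape : IsUnit β₈ := by
  by_contra hu
  have hmem : β₈ ∈ IsLocalRing.maximalIdeal ℤ_[3] := (IsLocalRing.mem_maximalIdeal _).mpr hu
  have h1 : β₈ + 1 ∈ IsLocalRing.maximalIdeal ℤ_[3] := by
    rw [PadicInt.maximalIdeal_eq_span_p, Ideal.mem_span_singleton]
    exact_mod_cast hβ₈
  have h : (1 : ℤ_[3]) ∈ IsLocalRing.maximalIdeal ℤ_[3] := by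
    simpa using Ideal.sub_mem _ h1 hmem
  exact (IsLocalRing.maximalIdeal.isMaximal ℤ_[3]).ne_top
    (Ideal.eq_top_of_isUnit_mem _ h isUnit_one)

/-- **(T1) `Ψ₃` is irreducible over `ℚ₃` on the `III*` shape**: `Ψ₃(3t) = 3⁵ · P(t)` with
`P = t⁴ + 3β₂t³ + 3β₄t² + 3β₆t + 3β₈` monic and Eisenstein at `3` (`β₈` a unit), and `t ↦ 3t`
is an automorphism of `ℚ₃[X]`. [folklore] -/
theorem irreducible_Ψ₃_of_IIIstarShape :
    Irreducible (M.map (algebraMap ℤ_[3] ℚ_[3])).Ψ₃ := by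
  have hu := isUnit_β₈_of_IIIstarShape hβ₈
  set P : ℤ_[3][X] := Polynomial.C 1 * X ^ 4 + Polynomial.C (3 * β₂) * X ^ 3 +
    Polynomial.C (3 * β₄) * X ^ 2 + Polynomial.C (3 * β₆) * X + Polynomial.C (3 * β₈) with hP
  have h3β₈ : 3 * β₈ ∉ IsLocalRing.maximalIdeal ℤ_[3] ^ 2 := by
    rw [PadicInt.maximalIdeal_eq_span_p, Ideal.span_singleton_pow, Ideal.mem_span_singleton]
    rintro ⟨c, hc⟩
    have h9 : β₈ = 3 * c := by
      have h3 : (3 : ℤ_[3]) ≠ 0 := by norm_num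
      apply mul_left_cancel₀ h3
      rw [hc]; push_cast; ring
    exact (IsLocalRing.mem_maximalIdeal _).mp
      (by rw [h9]; exact Ideal.mul_mem_right _ _ three_mem_maximalIdeal) hu
  have hEis : P.IsEisensteinAt (IsLocalRing.maximalIdeal ℤ_[3]) :=
    isEisensteinAt_quartic one_ne_zero
      (fun h ↦ (IsLocalRing.mem_maximalIdeal _).mp h isUnit_one)
      (Ideal.mul_mem_right _ _ three_mem_maximalIdeal)
      (Ideal.mul_mem_right _ _ three_mem_maximalIdeal)
      (Ideal.mul_mem_right _ _ three_mem_maximalIdeal)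
      (Ideal.mul_mem_right _ _ three_mem_maximalIdeal) h3β₈
  have hmonic : P.Monic := by
    rw [Monic, leadingCoeff_quartic one_ne_zero]
  have hirr : Irreducible P :=
    hEis.irreducible (IsLocalRing.maximalIdeal.isMaximal ℤ_[3]).isPrime hmonic.isPrimitive
      (by rw [natDegree_quartic one_ne_zero]; norm_num)
  have hirrK : Irreducible (P.map (algebraMap ℤ_[3] ℚ_[3])) :=
    (hmonic.irreducible_iff_irreducible_map_fraction_map (K := ℚ_[3])).mp hirr
  -- `Ψ₃(3X) = 3⁵ · P(X)` over `ℚ₃`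
  letI : Invertible (3 : ℚ_[3]) := invertibleOfNonzero (by norm_num)
  have hcomp : algEquivCMulXAddC (3 : ℚ_[3]) 0 (M.map (algebraMap ℤ_[3] ℚ_[3])).Ψ₃ =
      Polynomial.C (243 : ℚ_[3]) * P.map (algebraMap ℤ_[3] ℚ_[3]) := by
    rw [algEquivCMulXAddC_apply, ← comp_eq_aeval, Ψ₃_eq_quartic, hP]
    simp only [WeierstrassCurve.map_b₂, WeierstrassCurve.map_b₄, WeierstrassCurve.map_b₆,
      WeierstrassCurve.map_b₈, hb₂, hb₄, hb₆, hb₈, map_mul, map_ofNat, map_one, map_zero, add_zero,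
      add_comp, mul_comp, pow_comp, X_comp, C_comp, ofNat_comp, Polynomial.map_add,
      Polynomial.map_mul, Polynomial.map_pow, Polynomial.map_C, Polynomial.map_X,
      Polynomial.map_ofNat, Polynomial.map_one]
    ring
  have hunit : IsUnit (Polynomial.C (243 : ℚ_[3])) := isUnit_C.mpr (by norm_num)
  have key : Irreducible (algEquivCMulXAddC (3 : ℚ_[3]) 0 (M.map (algebraMap ℤ_[3] ℚ_[3])).Ψ₃) ↔
      Irreducible (M.map (algebraMap ℤ_[3] ℚ_[3])).Ψ₃ := MulEquiv.irreducible_iff _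
  rw [← key, hcomp, irreducible_isUnit_mul hunit]
  exact hirrK

/-- **(T2) `Ψ₃` has the root `x = 3ϖζ ∈ K₄` on the `III*` shape**, `ζ` the Hensel root of
`z⁴ + β₂ϖ³z³ + β₄ϖ²z² + β₆ϖz + β₈` (F1 `exists_root_quarticShape`): `Ψ₃(3ϖζ) = 3⁶ · 0`.
[folklore] -/
theorem exists_kummerRoot_Ψ₃_of_IIIstarShape :
    ∃ x : AdjoinRoot (X ^ 4 - C (3 : ℚ_[3])), aeval x (M.map (algebraMap ℤ_[3] ℚ_[3])).Ψ₃ = 0 := by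
  set ι : ℤ_[3] →+* AdjoinRoot (X ^ 4 - C (3 : ℚ_[3])) := algebraMap ℤ_[3] _ with hι
  set ϖ : AdjoinRoot (X ^ 4 - C (3 : ℚ_[3])) := AdjoinRoot.root (X ^ 4 - C (3 : ℚ_[3])) with hϖ
  have hϖ4 : ϖ ^ 4 = 3 := root_pow_four
  obtain ⟨ζ, hζ⟩ := exists_root_quarticShape β₈ β₆ β₄ β₂ hβ₈
  simp only [← algebraMap_padicInt_kummerField, ← hι] at hζ
  refine ⟨3 * ϖ * ζ, ?_⟩
  rw [aeval_Ψ₃_map, ← hι, hb₂, hb₄, hb₆, hb₈]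
  simp only [map_mul, map_ofNat]
  linear_combination (729 : AdjoinRoot (X ^ 4 - C (3 : ℚ_[3]))) * hζ + (243 * ζ ^ 4) * hϖ4

end IIIstar

/-! ## §3 The conclusion shape of `O5.SameDivisionQuarticAtThree` -/

/-- **Two curves over `ℚ₃` whose `3`-division quartics have roots in `K₄ = ℚ₃(3^{1/4})`, the first
irreducible, satisfy: `Ψ₃` is irreducible and `Ψ₃'` has a root in `ℚ₃[X]/(Ψ₃)`** — the shape of
`O5.SameDivisionQuarticAtThree` (F1 `exists_aeval_eq_zero_of_roots_in_kummerField`). [folklore] -/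
theorem irreducible_and_exists_aeval_of_kummerRoots {V V' : WeierstrassCurve ℚ_[3]}
    (hirr : Irreducible V.Ψ₃) {x x' : AdjoinRoot (X ^ 4 - C (3 : ℚ_[3]))}
    (hx : aeval x V.Ψ₃ = 0) (hx' : aeval x' V'.Ψ₃ = 0) :
    Irreducible V.Ψ₃ ∧ ∃ θ : AdjoinRoot V.Ψ₃, aeval θ V'.Ψ₃ = 0 :=
  ⟨hirr, exists_aeval_eq_zero_of_roots_in_kummerField hirr (V.natDegree_Ψ₃ (by norm_num)) hx hx'⟩

end Summit.BirchSwinnertonDyer.Rank1Residual.GaloisImage.PsiThreeKummer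

end
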